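import Literature.NumberTheory.Automorphic.SymplecticSatakeCountingImage
import Mathlib.Algebra.Order.Rearrangement
import Mathlib.Data.Fin.Tuple.Sort
import HarnessLib

/-!
# The twisted orbit sums `S_λ = ∑_{μ ∈ W(C_n)λ} q^{⟨ρ,λ⟩-⟨ρ,μ⟩} x^μ`, `λ` dominant, form an `R`-basis of the image
# `𝒯_R = 𝒮_1(ℋ(Sp_{2n}(K), Sp_{2n}(𝒪); R))` of the counting Satake transform; the orbit sums form an `R`-basis of `R[ℤⁿ]^{W(C_n)}`;
# `ℋ(Sp_{2n}, K₀; R)` is free on `𝒮_1⁻¹(S_λ)` — every commutative `R` (Henniart–Vignéras §7.13–§7.15; Zhu §1.3 Lemma 8)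

Topic `NumberTheory/Automorphic`; namespace `Literature.NumberTheory.Automorphic.SymplecticCartan` (lane `lit-hodgefound`,
Track 2 foundations; seat `lit-hodgefound-p11`, generation 50, row g50-#11).  Two DEFINITIONS with bodies (`signedPermOrbit λ`, the
`W(C_n)`-orbit of `λ ∈ ℤⁿ` as a `Finset`; `symplecticTwistedOrbitSum R n b λ`) + theorems; no named fact, no instance, no notation.
The `Sp_{2n}` analogue of `HyperspecialUnitarySatakeOrbitSumBasis` (g49-#8) and of §4–§6 of `IntegralSatakeIsomorphismGL` (g43-#1),
completing g50-#8 (`SymplecticSatakeCountingImage`: `𝒮_1(ℋ_R) = 𝒯_R(q)`).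

## The print

[HenniartVigneras2013] §7.13 (general `G`; here `G = Sp_{2n}`, `Λ = ℤⁿ`, `W_0 = W(C_n)`): «For each `λ` in `Λ⁻`, let `W_λ` be
its stabilizer in `W_0` and put `S_λ = ∑_{w ∈ W_0/W_λ} w ∘ e_λ` [twisted action] … THEOREM. — `S_ℤ` is injective and the family
`S_λ`, `λ` in `Λ⁻`, is a basis of its image»; PROPOSITION (proof): «if for some `w` in `W_0`, `w(λ)` is in `Λ⁻`, then `w(λ) = λ`»;
COROLLARY: «The family `(S_λ)_{λ ∈ Λ⁻}` is a basis for the submodule of `ℤ[Λ]` made out of elements invariant [under] the twisted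
action of `W_0`»; §7.15 THEOREM (any coefficient ring `C`) and Remark 1 («Assume `p · 1_C = 0`. […] `1_C ⊗ S_λ = 1_C ⊗ e_λ`»).
[ZhuIntegralSatake2020] §1.3 Lemma 8: «a `ℤ`-basis given by elements of the form `∑_{λ̂' ∈ W_0 λ̂} q^{⟨λ, λ̂' - λ̂⟩} e^{λ̂'}`».
[TreumannVenkatesh2016] §7.3: «The `W_{0,v}`-invariant regular functions have a basis parameterized by `W_{0,v}`-orbits on
`X^*(T̂)` […] the basis element corresponding to `W_{0,v} ν`, where `ν` is dominant, by `ω_ν`».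

CONVENTION (as in g50-#8): the tree's exponents make the DOMINANT element `λ` (antitone, `≥ 0`) of a `W(C_n)`-orbit the one
where `⟨ρ, ·⟩`, `ρ = (n, n-1, …, 1)`, is MAXIMAL and where `S_λ` has coefficient `1`; Henniart–Vignéras/Zhu/Herzig put the
coefficient `1` at the antidominant element (`x^μ ↔ x^{-μ}`, `-1 ∈ W(C_n)`).

## The mathematics

(1) RHO-MAXIMALITY (`symplecticRhoPairing_signedPerm_le`, `signedPerm_eq_self_of_le`): for `λ` dominant and `w = (ε, π) ∈ W(C_n)`,
`⟨ρ, wλ⟩ = Σ (n-i) ε_i λ_{π i} ≤ Σ (n-i) λ_{π i} ≤ Σ (n-i) λ_i = ⟨ρ, λ⟩` (signs: `λ ≥ 0`; permutation: the rearrangement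
inequality, `ρ` and `λ` both decreasing), with equality iff `wλ = λ` (`ρ` is STRICTLY decreasing and `> 0`, equality case of the
rearrangement inequality + uniqueness of the sorted rearrangement).  Hence the dominant element of an orbit is unique
(`eq_of_dominant_of_mem_signedPermOrbit`) and exists (`exists_dominant_mem_signedPermOrbit`, the head-sum maximum, g50-#6).
(2) `S_λ ∈ 𝒯_R(b)` (the exponents `⟨ρ,λ⟩-⟨ρ,μ⟩` are natural numbers by (1) and add up along the twisted relations);
`S_λ` has coefficient `1` at `x^λ` and `0` at every other dominant `x^μ`.  (3) For `f ∈ 𝒯_R(b)`,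
`f = Σ_{λ dominant} f_λ S_λ`: the difference lies in `𝒯_R(b)` and has no dominant exponent, hence is `0` (a non-zero element of
`𝒯_R(b)` has a dominant exponent: the relations read from the dominant end, g50-#8 `coeff_ne_zero_signedPerm_of_mem_twisted`); the `S_λ` are
linearly independent (coefficient extraction at dominant exponents); so `(S_λ)_{λ dominant}` is an `R`-basis of `𝒯_R(b)`, every `R`,
every `b`.  (4) `b = 1`: `𝒯_R(1) = R[ℤⁿ]^{W(C_n)}` and `S_λ = Σ_{μ ∈ Wλ} x^μ`, so the orbit sums are an `R`-basis of the invariants;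
`b = 0` in `R`: `S_λ = x^λ`.  (5) Transport through the counting isomorphism `𝒮_1 : ℋ_R ⥲ 𝒯_R(q)` (g50-#8): `ℋ(Sp_{2n}(K), Sp_{2n}(𝒪); R)`
is a free `R`-module with a basis `(B_λ)_{λ dominant}`, `𝒮_1(B_λ) = S_λ`.

## What is formalised

* §1 `symplecticRhoPairing_comp_perm_le`, `comp_perm_eq_self_of_antitone_of_le`, **`symplecticRhoPairing_signedPerm_le`**,
  **`signedPerm_eq_self_of_le`** ((1)).
* §2 `signedPermOrbit` + `mem_signedPermOrbit_iff`, `self_mem_signedPermOrbit`, `signedPerm_mem_signedPermOrbit_iff`, `mem_signedPermOrbit_comm`,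
  `symplecticRhoPairing_le_of_mem_signedPermOrbit`, **`eq_of_dominant_of_mem_signedPermOrbit`**, **`exists_dominant_mem_signedPermOrbit`**.
* §3 `symplecticTwistedOrbitSum` + `coeff_symplecticTwistedOrbitSum`, `…_self`, `…_eq_zero_of_dominant`,
  **`symplecticTwistedOrbitSum_mem_symplecticTwistedTarget`**, `symplecticTwistedOrbitSum_of_cast_eq_zero`, `symplecticTwistedOrbitSum_one`.
* §4 `exists_dominant_coeff_ne_zero_of_mem_twisted`, **`eq_sum_coeff_smul_symplecticTwistedOrbitSum_of_mem`**,
  **`linearIndependent_symplecticTwistedOrbitSum`**, **`exists_basis_symplecticTwistedTarget`** ((3)).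
* §5 `monomialTwist_symplecticSatakeWeight_one`, **`mem_symplecticTwistedTarget_one_iff`** (`𝒯_R(1) = R[ℤⁿ]^{W(C_n)}`),
  **`exists_basis_weylInvariants_symplecticWeylGroup`** ((4): the orbit sums are an `R`-basis of `R[ℤⁿ]^{W(C_n)}`).
* §6 `symplecticTwistedOrbitSum_mem_range_symplecticSatakeTransform_one`,
  **`exists_basis_heckeAlgebra_symplecticSatakeTransform_one_eq`** ((5)).

## References
* [HenniartVigneras2013] G. Henniart, M.-F. Vignéras, *A Satake isomorphism for representations modulo p of reductive groups over
  local fields*, J. reine angew. Math. 701 (2015) 33–75, §7.13 Thm./Prop./Cor., §7.15 Thm. and Remark 1.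
* [ZhuIntegralSatake2020] X. Zhu, *A note on integral Satake isomorphisms*, arXiv:2005.13056, §1.3 Lemma 8, §1.4.
* [TreumannVenkatesh2016] D. Treumann, A. Venkatesh, *Functoriality, Smith theory, and the Brauer homomorphism*, Ann. of Math. 183
  (2016), §7.2, §7.3.
* [CartierCorvallis1979] P. Cartier, *Representations of 𝔭-adic groups: a survey*, PSPM 33.1 (1979), §IV Thm. 4.1.
-/

noncomputable section

open scoped Valued WithZero MatrixGroups
open Matrix MonoidAlgebra Representation

namespace Literature.NumberTheory.Automorphic.SymplecticCartan

open Literature.NumberTheory.Automorphic Literature.NumberTheory.Automorphic.CartanUnique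
  Literature.NumberTheory.Automorphic.HermitianLattice

variable {R : Type*} [CommRing R] {n : ℕ}

/-! ## §1 `⟨ρ, ·⟩` is maximal on a `W(C_n)`-orbit exactly at the dominant element -/

section Rho

omit [CommRing R] in
/-- `ρ = (n, n-1, …, 1)` monovaries with every antitone `λ` (both decrease). [cite: ZhuIntegralSatake2020, §1.3 Lemma 8] -/
private theorem monovary_rho_of_antitone {la : Fin n → ℤ} (hla : Antitone la) :
    Monovary (fun i : Fin n => (n : ℤ) - (i : ℕ)) la := by
  intro i j hij
  have hji : j ≤ i := by
    by_contra h
    exact absurd (hla (le_of_lt (not_le.1 h))) (not_le.2 hij)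
  have := Fin.le_def.1 hji
  simp only
  omega

omit [CommRing R] in
/-- **Rearrangement**: `⟨ρ, λ ∘ π⟩ ≤ ⟨ρ, λ⟩` for `λ` antitone and every coordinate permutation `π`.
[cite: ZhuIntegralSatake2020, §1.3 Lemma 8] [cite: HenniartVigneras2013, §7.12 Lemma 2] -/
theorem symplecticRhoPairing_comp_perm_le {la : Fin n → ℤ} (hla : Antitone la) (π : Equiv.Perm (Fin n)) :
    symplecticRhoPairing (la ∘ π) ≤ symplecticRhoPairing la := by
  unfold symplecticRhoPairing
  simp only [Function.comp_apply]
  exact (monovary_rho_of_antitone hla).sum_mul_comp_perm_le_sum_mul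

omit [CommRing R] in
/-- **Equality case**: for `λ` antitone, `⟨ρ, λ⟩ ≤ ⟨ρ, λ ∘ π⟩` forces `λ ∘ π = λ` (`ρ` is strictly decreasing; the sorted
rearrangement is unique). [cite: ZhuIntegralSatake2020, §1.3 Lemma 8] [cite: HenniartVigneras2013, §7.13 Prop. (proof)] -/
theorem comp_perm_eq_self_of_antitone_of_le {la : Fin n → ℤ} (hla : Antitone la) (π : Equiv.Perm (Fin n))
    (h : symplecticRhoPairing la ≤ symplecticRhoPairing (la ∘ π)) : la ∘ π = la := by
  have heq : symplecticRhoPairing (la ∘ π) = symplecticRhoPairing la := le_antisymm (symplecticRhoPairing_comp_perm_le hla π) h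
  have hmv : Monovary (fun i : Fin n => (n : ℤ) - (i : ℕ)) (la ∘ π) := by
    refine (monovary_rho_of_antitone hla).sum_mul_comp_perm_eq_sum_mul_iff.1 ?_
    unfold symplecticRhoPairing at heq
    simpa only [Function.comp_apply] using heq
  -- `la ∘ π` is antitone
  have hanti : Antitone (la ∘ π) := by
    intro i j hij
    by_contra hlt
    have h1 := hmv (not_le.1 hlt)
    have h2 := Fin.le_def.1 hij
    simp only at h1
    have h3 : (i : ℕ) = j := by omega
    exact absurd (Fin.ext h3) (fun h => by rw [h] at hlt; exact hlt le_rfl)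
  -- uniqueness of the antitone rearrangement
  have hmono : Monotone ((fun i => -la i) ∘ π) := fun i j hij => neg_le_neg (hanti hij)
  have hmono' : Monotone ((fun i => -la i) ∘ (1 : Equiv.Perm (Fin n))) := fun i j hij => neg_le_neg (hla hij)
  have hu := Tuple.unique_monotone hmono hmono'
  funext i
  have hi := congr_fun hu i
  simp only [Function.comp_apply, Equiv.Perm.coe_one, id_eq, neg_inj] at hi
  exact hi

omit [CommRing R] in
/-- Signs only lower `⟨ρ, ·⟩` on non-negative vectors: `⟨ρ, (ε_i λ_{π i})_i⟩ ≤ ⟨ρ, λ ∘ π⟩` for `λ ≥ 0`.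
[cite: TreumannVenkatesh2016, §7.2] -/
theorem symplecticRhoPairing_signedPerm_le_comp_perm {la : Fin n → ℤ} (hnn : ∀ i, 0 ≤ la i) (ε : Fin n → ℤˣ)
    (π : Equiv.Perm (Fin n)) :
    symplecticRhoPairing (fun i => (ε i : ℤ) * la (π i)) ≤ symplecticRhoPairing (la ∘ π) := by
  unfold symplecticRhoPairing
  refine Finset.sum_le_sum fun i _ => ?_
  have hi := i.isLt
  have hρ : 0 ≤ (n : ℤ) - (i : ℕ) := by omega
  refine mul_le_mul_of_nonneg_left ?_ hρ
  change (ε i : ℤ) * la (π i) ≤ (la ∘ π) i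
  rw [Function.comp_apply]
  rcases Int.units_eq_one_or (ε i) with h | h <;> rw [h]
  · rw [Units.val_one, one_mul]
  · rw [Units.val_neg, Units.val_one, neg_one_mul]
    have := hnn (π i)
    omega

omit [CommRing R] in
/-- **`⟨ρ, wλ⟩ ≤ ⟨ρ, λ⟩` for `λ` dominant and every `w ∈ W(C_n)`** (so the twist exponents `⟨ρ,λ⟩-⟨ρ,μ⟩` on the orbit are
natural numbers). [cite: ZhuIntegralSatake2020, §1.3 Lemma 8] [cite: HenniartVigneras2013, §7.12 Lemma 2, §7.13] -/
theorem symplecticRhoPairing_signedPerm_le {la : Fin n → ℤ} (hla : Antitone la) (hnn : ∀ i, 0 ≤ la i) (ε : Fin n → ℤˣ)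
    (π : Equiv.Perm (Fin n)) :
    symplecticRhoPairing (fun i => (ε i : ℤ) * la (π i)) ≤ symplecticRhoPairing la :=
  (symplecticRhoPairing_signedPerm_le_comp_perm hnn ε π).trans (symplecticRhoPairing_comp_perm_le hla π)

omit [CommRing R] in
/-- **The dominant element of an orbit is its unique `⟨ρ,·⟩`-maximum**: for `λ` dominant, `⟨ρ, λ⟩ ≤ ⟨ρ, wλ⟩` forces `wλ = λ`
(HV: «if for some `w` in `W_0`, `w(λ)` is in `Λ⁻`, then `w(λ) = λ`»). [cite: HenniartVigneras2013, §7.13 Prop. (proof)]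
[cite: ZhuIntegralSatake2020, §1.3 Lemma 8] -/
theorem signedPerm_eq_self_of_le {la : Fin n → ℤ} (hla : Antitone la) (hnn : ∀ i, 0 ≤ la i) (ε : Fin n → ℤˣ)
    (π : Equiv.Perm (Fin n)) (h : symplecticRhoPairing la ≤ symplecticRhoPairing (fun i => (ε i : ℤ) * la (π i))) :
    (fun i => (ε i : ℤ) * la (π i)) = la := by
  have h1 := symplecticRhoPairing_signedPerm_le_comp_perm hnn ε π
  have h2 := symplecticRhoPairing_comp_perm_le hla π
  have hperm : la ∘ π = la := comp_perm_eq_self_of_antitone_of_le hla π (h.trans h1)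
  -- termwise equality in the sign step
  have hsum : ∑ i : Fin n, ((n : ℤ) - (i : ℕ)) * ((ε i : ℤ) * la (π i)) = ∑ i : Fin n, ((n : ℤ) - (i : ℕ)) * (la ∘ π) i :=
    le_antisymm h1 (h2.trans (h.trans le_rfl))
  have hterm : ∀ i ∈ (Finset.univ : Finset (Fin n)),
      ((n : ℤ) - (i : ℕ)) * ((ε i : ℤ) * la (π i)) ≤ ((n : ℤ) - (i : ℕ)) * (la ∘ π) i := by
    intro i _
    have hi := i.isLt
    have hρ : 0 ≤ (n : ℤ) - (i : ℕ) := by omega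
    refine mul_le_mul_of_nonneg_left ?_ hρ
    rw [Function.comp_apply]
    rcases Int.units_eq_one_or (ε i) with h | h <;> rw [h]
    · rw [Units.val_one, one_mul]
    · rw [Units.val_neg, Units.val_one, neg_one_mul]
      have := hnn (π i)
      omega
  have heach := (Finset.sum_eq_sum_iff_of_le hterm).1 hsum
  funext i
  have hi := heach i (Finset.mem_univ i)
  have hlt := i.isLt
  have hρ : 0 < (n : ℤ) - (i : ℕ) := by omega
  have hc := mul_left_cancel₀ hρ.ne' hi
  rw [Function.comp_apply] at hc
  rw [hc, ← Function.comp_apply (f := la) (g := π) (x := i), hperm]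

end Rho

/-! ## §2 The `W(C_n)`-orbit of a cocharacter -/

section Orbit

/-- **The `W(C_n)`-orbit `Wλ = {(ε_i λ_{π i})_i : ε ∈ {±1}ⁿ, π ∈ S_n}` of `λ ∈ ℤⁿ`**, as a finite set.
[cite: HenniartVigneras2013, §7.13] [cite: ZhuIntegralSatake2020, §1.3 Lemma 8] -/
def signedPermOrbit (la : Fin n → ℤ) : Finset (Fin n → ℤ) :=
  Finset.univ.image fun p : (Fin n → ℤˣ) × Equiv.Perm (Fin n) => fun i => (p.1 i : ℤ) * la (p.2 i)

omit [CommRing R] in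
/-- Membership in the orbit. [cite: HenniartVigneras2013, §7.13] -/
theorem mem_signedPermOrbit_iff {la μ : Fin n → ℤ} :
    μ ∈ signedPermOrbit la ↔ ∃ (ε : Fin n → ℤˣ) (π : Equiv.Perm (Fin n)), (fun i => (ε i : ℤ) * la (π i)) = μ := by
  simp only [signedPermOrbit, Finset.mem_image, Finset.mem_univ, true_and, Prod.exists]

omit [CommRing R] in
/-- `λ ∈ Wλ`. [cite: HenniartVigneras2013, §7.13] -/
theorem self_mem_signedPermOrbit (la : Fin n → ℤ) : la ∈ signedPermOrbit la :=
  mem_signedPermOrbit_iff.2 ⟨fun _ => 1, 1, funext fun i => by rw [Units.val_one, one_mul, Equiv.Perm.coe_one, id_eq]⟩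

omit [CommRing R] in
/-- The orbit is `W(C_n)`-stable: `wμ ∈ Wλ ⟺ μ ∈ Wλ`. [cite: HenniartVigneras2013, §7.13] -/
theorem signedPerm_mem_signedPermOrbit_iff {la μ : Fin n → ℤ} (ε : Fin n → ℤˣ) (π : Equiv.Perm (Fin n)) :
    (fun i => (ε i : ℤ) * μ (π i)) ∈ signedPermOrbit la ↔ μ ∈ signedPermOrbit la := by
  constructor
  · intro h
    obtain ⟨ε₁, π₁, h1⟩ := mem_signedPermOrbit_iff.1 h
    refine mem_signedPermOrbit_iff.2 ⟨fun j => ε (π.symm j) * ε₁ (π.symm j), π₁ * π.symm, ?_⟩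
    rw [← signedPerm_inv_apply ε π μ]
    funext j
    have hj : (ε₁ (π.symm j) : ℤ) * la (π₁ (π.symm j)) = (ε (π.symm j) : ℤ) * μ (π (π.symm j)) := congr_fun h1 (π.symm j)
    change ((ε (π.symm j) * ε₁ (π.symm j) : ℤˣ) : ℤ) * la ((π₁ * π.symm) j) =
      (ε (π.symm j) : ℤ) * ((ε (π.symm j) : ℤ) * μ (π (π.symm j)))
    rw [Units.val_mul, Equiv.Perm.coe_mul, Function.comp_apply, mul_assoc, hj]
  · intro h
    obtain ⟨ε₁, π₁, rfl⟩ := mem_signedPermOrbit_iff.1 h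
    refine mem_signedPermOrbit_iff.2 ⟨fun i => ε i * ε₁ (π i), π₁ * π, funext fun i => ?_⟩
    simp only
    rw [Units.val_mul, Equiv.Perm.coe_mul, Function.comp_apply, mul_assoc]

omit [CommRing R] in
/-- The orbit relation is symmetric. [cite: HenniartVigneras2013, §7.13] -/
theorem mem_signedPermOrbit_comm {la μ : Fin n → ℤ} : μ ∈ signedPermOrbit la ↔ la ∈ signedPermOrbit μ := by
  suffices h : ∀ {a b : Fin n → ℤ}, b ∈ signedPermOrbit a → a ∈ signedPermOrbit b from ⟨h, h⟩
  intro a b hb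
  obtain ⟨ε, π, rfl⟩ := mem_signedPermOrbit_iff.1 hb
  exact mem_signedPermOrbit_iff.2 ⟨fun j => ε (π.symm j), π.symm, signedPerm_inv_apply ε π a⟩

omit [CommRing R] in
/-- **`⟨ρ, μ⟩ ≤ ⟨ρ, λ⟩` on the orbit of a dominant `λ`.** [cite: ZhuIntegralSatake2020, §1.3 Lemma 8] [cite: HenniartVigneras2013, §7.13] -/
theorem symplecticRhoPairing_le_of_mem_signedPermOrbit {la μ : Fin n → ℤ} (hla : Antitone la) (hnn : ∀ i, 0 ≤ la i)
    (h : μ ∈ signedPermOrbit la) : symplecticRhoPairing μ ≤ symplecticRhoPairing la := by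
  obtain ⟨ε, π, rfl⟩ := mem_signedPermOrbit_iff.1 h
  exact symplecticRhoPairing_signedPerm_le hla hnn ε π

omit [CommRing R] in
/-- **The dominant element of a `W(C_n)`-orbit is unique.** [cite: HenniartVigneras2013, §7.13 Prop. (proof)] -/
theorem eq_of_dominant_of_mem_signedPermOrbit {la μ : Fin n → ℤ} (hla : Antitone la) (hnn : ∀ i, 0 ≤ la i) (hμ : Antitone μ)
    (hμnn : ∀ i, 0 ≤ μ i) (h : μ ∈ signedPermOrbit la) : μ = la := by
  have h1 := symplecticRhoPairing_le_of_mem_signedPermOrbit hμ hμnn (mem_signedPermOrbit_comm.1 h)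
  obtain ⟨ε, π, rfl⟩ := mem_signedPermOrbit_iff.1 h
  exact signedPerm_eq_self_of_le hla hnn ε π h1

omit [CommRing R] in
/-- **Every `μ ∈ ℤⁿ` lies in the orbit of a dominant `λ`** (the head-sum maximum of the orbit, g50-#6). [cite: HenniartVigneras2013, §6.3, §7.13]
[cite: CartierCorvallis1979, §IV, proof of Thm. 4.1 (c)] -/
theorem exists_dominant_mem_signedPermOrbit (μ : Fin n → ℤ) :
    ∃ la : Fin n → ℤ, (Antitone la ∧ ∀ i, 0 ≤ la i) ∧ μ ∈ signedPermOrbit la := by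
  have hS : ∀ ν ∈ signedPermOrbit μ, ∀ (ε : Fin n → ℤˣ) (π : Equiv.Perm (Fin n)),
      (fun i => (ε i : ℤ) * ν (π i)) ∈ signedPermOrbit μ := fun ν hν ε π => (signedPerm_mem_signedPermOrbit_iff ε π).2 hν
  obtain ⟨a, haS, hmax⟩ := (signedPermOrbit μ).exists_max_image (fun ν => toLex (headSumVec ν)) ⟨μ, self_mem_signedPermOrbit μ⟩
  exact ⟨a, antitone_nonneg_of_isMaxOn_headSumVec hS haS hmax, mem_signedPermOrbit_comm.1 haS⟩

end Orbit

/-! ## §3 The twisted orbit sums `S_λ` -/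

section OrbitSum

variable (R n) in
/-- **The twisted orbit sum `S_λ = ∑_{μ ∈ Wλ} b^{⟨ρ,λ⟩-⟨ρ,μ⟩} x^μ ∈ R[ℤⁿ]`** (`b = q`; Henniart–Vignéras' `∑_{w ∈ W_0/W_λ} w ∘ e_λ` for
the twisted action, Zhu's `∑_{λ̂' ∈ W_0 λ̂} q^{⟨ρ, λ̂'-λ̂⟩} e^{λ̂'}`, in the tree's dominant convention). [cite: HenniartVigneras2013, §7.13]
[cite: ZhuIntegralSatake2020, §1.3 Lemma 8] -/
def symplecticTwistedOrbitSum (b : ℕ) (la : Fin n → ℤ) : AddMonoidAlgebra R (Fin n → ℤ) :=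
  ∑ μ ∈ signedPermOrbit la, ((b : R) ^ (symplecticRhoPairing la - symplecticRhoPairing μ).toNat) • AddMonoidAlgebra.single μ (1 : R)

/-- **Coefficients of `S_λ`**: `b^{⟨ρ,λ⟩-⟨ρ,μ⟩}` on the orbit, `0` off it. [cite: HenniartVigneras2013, §7.13] -/
theorem coeff_symplecticTwistedOrbitSum (b : ℕ) (la μ : Fin n → ℤ) :
    (symplecticTwistedOrbitSum R n b la).coeff μ =
      if μ ∈ signedPermOrbit la then (b : R) ^ (symplecticRhoPairing la - symplecticRhoPairing μ).toNat else 0 := by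
  classical
  rw [symplecticTwistedOrbitSum, AddMonoidAlgebra.coeff_sum, Finsupp.finsetSum_apply]
  simp only [AddMonoidAlgebra.coeff_smul, Finsupp.smul_apply, AddMonoidAlgebra.coeff_single, Finsupp.single_apply,
    smul_eq_mul, mul_ite, mul_one, mul_zero]
  rw [Finset.sum_ite_eq']

/-- `S_λ` has coefficient `1` at `x^λ`. [cite: HenniartVigneras2013, §7.13] -/
theorem coeff_symplecticTwistedOrbitSum_self (b : ℕ) (la : Fin n → ℤ) : (symplecticTwistedOrbitSum R n b la).coeff la = 1 := by
  rw [coeff_symplecticTwistedOrbitSum, if_pos (self_mem_signedPermOrbit la), sub_self, Int.toNat_zero, pow_zero]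

/-- For `λ` and `μ ≠ λ` both dominant, `S_λ` has no `x^μ` term. [cite: HenniartVigneras2013, §7.13 Prop. (proof)] -/
theorem coeff_symplecticTwistedOrbitSum_eq_zero_of_dominant {b : ℕ} {la μ : Fin n → ℤ} (hla : Antitone la ∧ ∀ i, 0 ≤ la i)
    (hμ : Antitone μ ∧ ∀ i, 0 ≤ μ i) (hne : μ ≠ la) : (symplecticTwistedOrbitSum R n b la).coeff μ = 0 := by
  rw [coeff_symplecticTwistedOrbitSum, if_neg]
  exact fun h => hne (eq_of_dominant_of_mem_signedPermOrbit hla.1 hla.2 hμ.1 hμ.2 h)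

/-- **`S_λ ∈ 𝒯_R(b)`**: the twisted orbit sum of a dominant `λ` satisfies the twisted relations. [cite: HenniartVigneras2013, §7.13]
[cite: ZhuIntegralSatake2020, §1.3 Lemma 8] -/
theorem symplecticTwistedOrbitSum_mem_symplecticTwistedTarget (b : ℕ) {la : Fin n → ℤ} (hla : Antitone la ∧ ∀ i, 0 ≤ la i) :
    symplecticTwistedOrbitSum R n b la ∈ symplecticTwistedTarget R n b := by
  intro μ ε π hle
  rw [coeff_symplecticTwistedOrbitSum, coeff_symplecticTwistedOrbitSum]
  by_cases hμ : μ ∈ signedPermOrbit la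
  · rw [if_pos ((signedPerm_mem_signedPermOrbit_iff ε π).2 hμ), if_pos hμ, ← pow_add]
    congr 1
    have h1 := symplecticRhoPairing_le_of_mem_signedPermOrbit hla.1 hla.2 hμ
    omega
  · rw [if_neg (fun h => hμ ((signedPerm_mem_signedPermOrbit_iff ε π).1 h)), if_neg hμ, mul_zero]

/-- **`S_λ = x^λ` when `b = 0` in `R`**: every other orbit element carries a positive power of `b`.
[cite: HenniartVigneras2013, §7.15 Remark 1] -/
theorem symplecticTwistedOrbitSum_of_cast_eq_zero {b : ℕ} (hb : (b : R) = 0) {la : Fin n → ℤ} (hla : Antitone la ∧ ∀ i, 0 ≤ la i) :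
    symplecticTwistedOrbitSum R n b la = AddMonoidAlgebra.single la (1 : R) := by
  classical
  refine AddMonoidAlgebra.coeff_injective (Finsupp.ext fun μ => ?_)
  rw [coeff_symplecticTwistedOrbitSum, AddMonoidAlgebra.coeff_single, Finsupp.single_apply]
  by_cases hμ : μ ∈ signedPermOrbit la
  · rw [if_pos hμ]
    by_cases heq : la = μ
    · rw [if_pos heq, heq, sub_self, Int.toNat_zero, pow_zero]
    · rw [if_neg heq, hb, zero_pow]
      intro h0
      obtain ⟨ε, π, rfl⟩ := mem_signedPermOrbit_iff.1 hμ
      exact heq (signedPerm_eq_self_of_le hla.1 hla.2 ε π (by have := Int.toNat_eq_zero.1 h0; omega)).symm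
  · rw [if_neg hμ, if_neg]
    rintro rfl
    exact hμ (self_mem_signedPermOrbit la)

/-- **`b = 1`: `S_λ = ∑_{μ ∈ Wλ} x^μ` is the plain orbit sum.** [cite: TreumannVenkatesh2016, §7.3] -/
theorem symplecticTwistedOrbitSum_one (la : Fin n → ℤ) :
    symplecticTwistedOrbitSum R n 1 la = ∑ μ ∈ signedPermOrbit la, AddMonoidAlgebra.single μ (1 : R) := by
  refine Finset.sum_congr rfl fun μ _ => ?_
  rw [Nat.cast_one, one_pow, one_smul]

end OrbitSum

/-! ## §4 `(S_λ)_{λ dominant}` is an `R`-basis of `𝒯_R(b)` -/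

section BasisTarget

/-- **An element of `𝒯_R` is detected on the dominant cone**: if `f ∈ 𝒯_R(b)` and `f_μ ≠ 0` then `f_λ ≠ 0` at the dominant
representative `λ` of `Wμ`. [cite: HenniartVigneras2013, §7.13 Cor. (proof)] -/
theorem exists_dominant_coeff_ne_zero_of_mem_twisted {b : ℕ} {f : AddMonoidAlgebra R (Fin n → ℤ)}
    (hf : f ∈ symplecticTwistedTarget R n b) {μ : Fin n → ℤ} (hμ : f.coeff μ ≠ 0) :
    ∃ la : Fin n → ℤ, (Antitone la ∧ ∀ i, 0 ≤ la i) ∧ μ ∈ signedPermOrbit la ∧ f.coeff la ≠ 0 := by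
  obtain ⟨la, hla, hmem⟩ := exists_dominant_mem_signedPermOrbit μ
  obtain ⟨ε, π, hw⟩ := mem_signedPermOrbit_iff.1 (mem_signedPermOrbit_comm.1 hmem)
  refine ⟨la, hla, hmem, ?_⟩
  rw [← hw]
  refine coeff_ne_zero_signedPerm_of_mem_twisted hf hμ ε π ?_
  rw [hw]
  exact symplecticRhoPairing_le_of_mem_signedPermOrbit hla.1 hla.2 hmem

/-- **`f = ∑_{λ dominant, f_λ ≠ 0} f_λ S_λ` for every `f ∈ 𝒯_R(b)`**: the difference lies in `𝒯_R(b)` and has no dominant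
exponent, hence vanishes. [cite: HenniartVigneras2013, §7.13 Cor.] [cite: ZhuIntegralSatake2020, §1.3 Lemma 8] -/
theorem eq_sum_coeff_smul_symplecticTwistedOrbitSum_of_mem {b : ℕ} {f : AddMonoidAlgebra R (Fin n → ℤ)}
    (hf : f ∈ symplecticTwistedTarget R n b) :
    f = ∑ la ∈ f.coeff.support.filter (fun la => Antitone la ∧ ∀ i, 0 ≤ la i),
      f.coeff la • symplecticTwistedOrbitSum R n b la := by
  classical
  rw [← sub_eq_zero]
  set g := f - ∑ la ∈ f.coeff.support.filter (fun la => Antitone la ∧ ∀ i, 0 ≤ la i),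
    f.coeff la • symplecticTwistedOrbitSum R n b la with hg
  have hgmem : g ∈ symplecticTwistedTarget R n b :=
    Submodule.sub_mem _ hf (Submodule.sum_mem _ fun la hla => Submodule.smul_mem _ _
      (symplecticTwistedOrbitSum_mem_symplecticTwistedTarget b (Finset.mem_filter.1 hla).2))
  -- the coefficients of `g` on the dominant cone vanish
  have hgm : ∀ m : Fin n → ℤ, (Antitone m ∧ ∀ i, 0 ≤ m i) → g.coeff m = 0 := by
    intro m hm
    rw [hg, AddMonoidAlgebra.coeff_sub, Finsupp.sub_apply, AddMonoidAlgebra.coeff_sum, Finsupp.finsetSum_apply, sub_eq_zero]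
    simp only [AddMonoidAlgebra.coeff_smul, Finsupp.smul_apply, smul_eq_mul]
    rw [Finset.sum_eq_single m (fun la hla hne => ?_) (fun hm' => ?_), coeff_symplecticTwistedOrbitSum_self, mul_one]
    · rw [coeff_symplecticTwistedOrbitSum_eq_zero_of_dominant (Finset.mem_filter.1 hla).2 hm (Ne.symm hne), mul_zero]
    · have h0 : f.coeff m = 0 := by
        by_contra h0
        exact hm' (Finset.mem_filter.2 ⟨Finsupp.mem_support_iff.2 h0, hm⟩)
      rw [h0, zero_mul]
  -- hence `g = 0`
  by_contra hne
  obtain ⟨μ, hμ⟩ : ∃ μ, g.coeff μ ≠ 0 := by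
    by_contra hall
    push Not at hall
    exact hne (AddMonoidAlgebra.coeff_eq_zero.1 (Finsupp.ext hall))
  obtain ⟨la, hla, -, hgla⟩ := exists_dominant_coeff_ne_zero_of_mem_twisted hgmem hμ
  exact hgla (hgm la hla)

/-- **The twisted orbit sums `S_λ`, `λ` dominant, are `R`-linearly independent.** [cite: HenniartVigneras2013, §7.13 Prop.]
[cite: ZhuIntegralSatake2020, §1.3 Lemma 8] -/
theorem linearIndependent_symplecticTwistedOrbitSum (b : ℕ) :
    LinearIndependent R fun la : {la : Fin n → ℤ // Antitone la ∧ ∀ i, 0 ≤ la i} => symplecticTwistedOrbitSum R n b la.1 := by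
  classical
  rw [linearIndependent_iff']
  intro s g hsum la hla
  have h := congrArg (fun x : AddMonoidAlgebra R (Fin n → ℤ) => x.coeff la.1) hsum
  rw [AddMonoidAlgebra.coeff_sum, Finsupp.finsetSum_apply, AddMonoidAlgebra.coeff_zero, Finsupp.zero_apply,
    Finset.sum_eq_single la (fun la' _ hne => ?_) (fun h' => absurd hla h'), AddMonoidAlgebra.coeff_smul, Finsupp.smul_apply,
    coeff_symplecticTwistedOrbitSum_self, smul_eq_mul, mul_one] at h
  · exact h
  · rw [AddMonoidAlgebra.coeff_smul, Finsupp.smul_apply,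
      coeff_symplecticTwistedOrbitSum_eq_zero_of_dominant la'.2 la.2 (fun he => hne (Subtype.ext he.symm)), smul_zero]

/-- **`(S_λ)_{λ dominant}` IS AN `R`-BASIS OF `𝒯_R(b)`**, every commutative `R`, every base `b`. [cite: HenniartVigneras2013, §7.13 Cor.]
[cite: ZhuIntegralSatake2020, §1.3 Lemma 8] -/
theorem exists_basis_symplecticTwistedTarget (b : ℕ) :
    ∃ B : Module.Basis {la : Fin n → ℤ // Antitone la ∧ ∀ i, 0 ≤ la i} R (symplecticTwistedTarget R n b),
      ∀ la, (B la : AddMonoidAlgebra R (Fin n → ℤ)) = symplecticTwistedOrbitSum R n b la.1 := by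
  classical
  set v : {la : Fin n → ℤ // Antitone la ∧ ∀ i, 0 ≤ la i} → symplecticTwistedTarget R n b :=
    fun la => ⟨symplecticTwistedOrbitSum R n b la.1, symplecticTwistedOrbitSum_mem_symplecticTwistedTarget b la.2⟩ with hv
  have hli : LinearIndependent R v :=
    LinearIndependent.of_comp (symplecticTwistedTarget R n b).subtype (linearIndependent_symplecticTwistedOrbitSum b)
  have hsp : ⊤ ≤ Submodule.span R (Set.range v) := by
    rintro ⟨f, hf⟩ -
    rw [← Submodule.apply_mem_span_image_iff_mem_span (Submodule.injective_subtype _), ← Set.range_comp,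
      Submodule.subtype_apply]
    change f ∈ _
    rw [eq_sum_coeff_smul_symplecticTwistedOrbitSum_of_mem hf]
    exact Submodule.sum_mem _ fun la hla =>
      Submodule.smul_mem _ _ (Submodule.subset_span ⟨⟨la, (Finset.mem_filter.1 hla).2⟩, rfl⟩)
  exact ⟨Module.Basis.mk hli hsp, fun la => by rw [Module.Basis.mk_apply]⟩

end BasisTarget

/-! ## §5 `b = 1`: the orbit sums are an `R`-basis of `R[ℤⁿ]^{W(C_n)}` -/

section Invariants

/-- `monomialTwist(w_1) = id`. [cite: CartierCorvallis1979, §IV (4.2)] -/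
theorem monomialTwist_symplecticSatakeWeight_one (f : AddMonoidAlgebra R (Fin n → ℤ)) :
    monomialTwist (symplecticSatakeWeight (n := n) (1 : Rˣ)) f = f := by
  refine AddMonoidAlgebra.coeff_injective (Finsupp.ext fun μ => ?_)
  rw [coeff_monomialTwist, symplecticSatakeWeight_ofAdd, _root_.one_zpow, Units.val_one, one_mul]

/-- **`𝒯_R(1) = R[ℤⁿ]^{W(C_n)}`**: with base `b = 1` the twisted relations are plain `W(C_n)`-invariance. [cite: HenniartVigneras2013, §7.13]
[cite: TreumannVenkatesh2016, §7.3] -/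
theorem mem_symplecticTwistedTarget_one_iff (f : AddMonoidAlgebra R (Fin n → ℤ)) :
    f ∈ symplecticTwistedTarget R n 1 ↔ f ∈ weylInvariants R (Fin n → ℤ) (symplecticWeylGroup n) := by
  rw [mem_symplecticTwistedTarget_iff_monomialTwist_mem_weylInvariants (1 : Rˣ) (by rw [Units.val_one, Nat.cast_one]) f,
    monomialTwist_symplecticSatakeWeight_one]

/-- **THE ORBIT SUMS `∑_{μ ∈ Wλ} x^μ`, `λ` DOMINANT, ARE AN `R`-BASIS OF THE INVARIANTS `R[ℤⁿ]^{W(C_n)}`**, every commutative `R`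
(«The `W_0`-invariant regular functions have a basis parameterized by `W_0`-orbits […] `ω_ν`, `ν` dominant»).
[cite: TreumannVenkatesh2016, §7.3] [cite: HenniartVigneras2013, §7.13 Cor.] -/
theorem exists_basis_weylInvariants_symplecticWeylGroup :
    ∃ B : Module.Basis {la : Fin n → ℤ // Antitone la ∧ ∀ i, 0 ≤ la i} R (weylInvariants R (Fin n → ℤ) (symplecticWeylGroup n)),
      ∀ la, (B la : AddMonoidAlgebra R (Fin n → ℤ)) = ∑ μ ∈ signedPermOrbit la.1, AddMonoidAlgebra.single μ (1 : R) := by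
  obtain ⟨B, hB⟩ := exists_basis_symplecticTwistedTarget (R := R) (n := n) 1
  have heq : symplecticTwistedTarget R n 1 = Subalgebra.toSubmodule (weylInvariants R (Fin n → ℤ) (symplecticWeylGroup n)) :=
    Submodule.ext fun f => mem_symplecticTwistedTarget_one_iff f
  refine ⟨B.map (LinearEquiv.ofEq _ _ heq), fun la => ?_⟩
  rw [Module.Basis.map_apply, ← symplecticTwistedOrbitSum_one, ← hB la]
  rfl

end Invariants

/-! ## §6 Transport to `ℋ(Sp_{2n}(K), Sp_{2n}(𝒪); R)` -/

section Hecke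

variable {K : Type*} [Field K] [Valued K ℤᵐ⁰] {ϖ : K} [CompactSpace 𝒪[K]] [Finite 𝓀[K]]

/-- **`S_λ ∈ 𝒮_1(ℋ(Sp_{2n}, K₀; R))`** for every dominant `λ` and every commutative `R` (g50-#8: `𝒮_1(ℋ_R) = 𝒯_R(q)`).
[cite: HenniartVigneras2013, §7.14, §7.15] -/
theorem symplecticTwistedOrbitSum_mem_range_symplecticSatakeTransform_one (hϖ : Valued.v ϖ = WithZero.exp (-1 : ℤ))
    {la : Fin n → ℤ} (hla : Antitone la ∧ ∀ i, 0 ≤ la i) :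
    ∃ T : heckeAlgebra R (symplecticGroup (Fin n) K) (symplecticInt (Fin n) K),
      symplecticSatakeTransform hϖ 1 T = symplecticTwistedOrbitSum R n (Nat.card 𝓀[K]) la :=
  exists_symplecticSatakeTransform_one_eq_of_mem_twisted hϖ _ (symplecticTwistedOrbitSum_mem_symplecticTwistedTarget _ hla)

/-- **HENNIART–VIGNÉRAS §7.13/§7.15 FOR `Sp_{2n}`: `ℋ(Sp_{2n}(K), Sp_{2n}(𝒪); R)` is a FREE `R`-module with a basis
`(B_λ)_{λ dominant}` whose counting Satake transforms are the twisted orbit sums, `𝒮_1(B_λ) = S_λ = ∑_{μ ∈ Wλ} q^{⟨ρ,λ⟩-⟨ρ,μ⟩} x^μ`**,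
for every commutative ring `R`. [cite: HenniartVigneras2013, §7.13 Thm., §7.15 Thm.] [cite: ZhuIntegralSatake2020, §1.3 Lemma 8, §1.4] -/
theorem exists_basis_heckeAlgebra_symplecticSatakeTransform_one_eq (hϖ : Valued.v ϖ = WithZero.exp (-1 : ℤ)) :
    ∃ B : Module.Basis {la : Fin n → ℤ // Antitone la ∧ ∀ i, 0 ≤ la i} R
        (heckeAlgebra R (symplecticGroup (Fin n) K) (symplecticInt (Fin n) K)),
      ∀ la, symplecticSatakeTransform hϖ 1 (B la) = symplecticTwistedOrbitSum R n (Nat.card 𝓀[K]) la.1 := by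
  obtain ⟨B, hB⟩ := exists_basis_symplecticTwistedTarget (R := R) (n := n) (Nat.card 𝓀[K])
  refine ⟨B.map (symplecticCountingSatakeLinearEquiv hϖ).symm, fun la => ?_⟩
  rw [Module.Basis.map_apply, ← hB la, ← symplecticCountingSatakeLinearEquiv_apply hϖ, LinearEquiv.apply_symm_apply]

end Hecke

end Literature.NumberTheory.Automorphic.SymplecticCartan

end
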